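import Literature.Computability.Complexity.CircuitReduce
import Literature.Computability.AlgebraicComplexity.DawarWilsenach2025
import Literature.ModelTheory.FiniteModelTheory.SymmetricCircuitCountingWidthProofs
import Mathlib.Tactic.DeriveFintype
import HarnessLib

/-!
# From symmetric arithmetic circuits to symmetric threshold circuits
# (Dawar–Wilsenach 2025, Theorem 5.1, in the family form used for Theorem 7.1)

Everything PROVED; no named facts. Support for the discharge of the named fact
`DawarWilsenach2025_thm71` (`DawarWilsenach2025.lean`): the tree's reduction
`DawarWilsenach2025_thm71_of_thm51_thm64_thm72` (`DawarWilsenach2025Proofs.lean`) takes Theorem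
5.1 as its hypothesis `h51`; `DawarWilsenach2025_thm51_family` below IS that hypothesis (the
assembly with Theorem 7.2 is appended to `DawarWilsenach2025Proofs.lean`).

## The printed theorem and its proof (pp. 13–16)

"**Theorem 5.1.** Let `G` be a group acting on a set of variables `X`. Let `Φ` be a `Γ`-symmetric
arithmetic circuit over a field `F` with variables `X`, and let `S ⊆ F` be finite. Then there is a
`Γ`-symmetric threshold circuit `Ψ` with `ORB(Ψ) = ORB(Φ)`, such that for all `M ∈ {0,1}^X` we
have `Φ[M] ∈ S` if, and only if, `Ψ[M] = 1`." The printed proof evaluates `Φ` on `0/1` inputs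
only, so that every gate `v` takes finitely many values `Q_v`; it replaces `v` by Boolean gates
`(v, c)`, `c ∈ Q_v`, computing "`v` evaluates to `c`" through PARTITION-SYMMETRIC functions of
the indicators of the children (Lemma 5.3: the value of a `+`/`×` gate is determined by HOW MANY
children take each value), realised by symmetric threshold circuits (Lemma 5.2), and shows that
automorphisms of `Φ` extend to `Ψ` and conversely.

## What is formalised (for `Γ = Sym_n` acting diagonally on `X = [n] × [n]`, one output)

* `LabelledArithCircuit.tdag Φ S : GateDAG` — the Boolean DAG `Ψ(Φ, S)`: for every gate `g` of
  `Φ` and every value `c` of the (global, finite) value universe `Φ.vals`, the MAJORITY gates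
  `thr g c k` = "at least `k` children of `g` have value `c`" (threshold `k` realised by `MAJ`
  with constant padding, `maj_pad_iff`), exact counts `exa g c k`, PROFILE gates `prof g p`
  (`p` a count for each value), and the INDICATOR `ind g c` = "some valid profile is the actual
  one", valid meaning `∑_c' p(c')·c' = c` (`+`) resp. `∏_c' c'^{p(c')} = c` (`×`)
  (`LabelledArithCircuit.Valid`); inputs `x` contribute the wire `x`, its negation, or a
  constant; the output is `⋁_{c ∈ S} ind(out, c)`.
* SEMANTICS (`wire_indW`, `evalOut_tdag`): `ind g c` carries `[Φ_g[A] = c]`, by well-founded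
  induction along `Φ`, the counting identities `sum_cnt_smul` / `prod_pow_cnt` being Lemma 5.3.
* SYMMETRY (`isAut_tdag`): an automorphism `τ` of `Φ` over `ρ ∈ Sym_n` acts on the gates of
  `Ψ(Φ, S)` by `g ↦ τ g` in every layer (`tperm`), an automorphism over the diagonal action of `ρ`.
* ORBITS: instead of the printed converse ("every automorphism of `Ψ` comes from one of `Φ`",
  pp. 15–16) we RIGIDIFY: the delivered circuit is the reduced form (`GateDAG.reduce`,
  Anderson–Dawar 2017, Lemma 7, file `CircuitReduce.lean`) of `Ψ(Φ, S)`, compiled to a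
  straight-line program (`thresholdCircuit`); in a reduced circuit all automorphisms over a given
  input permutation coincide, so its orbits are traced by the automorphisms induced from `Φ`
  (`GateDAG.ncard_orbit_reduce_le`), whence `ORB(Ψ) ≤ ORB(Φ) + n² + 1`
  (`thresholdCircuit_orbitSize_le`; the `n²` negated inputs and the constants have no
  counterpart among the gates of `Φ` — in print inputs are gates and contribute orbits of the same
  size). This one-sided bound is all that "orbit size `2^{o(n)}`" needs
  (`DawarWilsenach2025_thm51_family`); the printed equality `ORB(Ψ) = ORB(Φ)` is not claimed.
* The hypotheses "`S` finite" and "`F` of characteristic `0`" are not used.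

## References

* A. Dawar, G. Wilsenach, *Symmetric arithmetic circuits*, Theory of Computing 21 (14), 2025,
  §5: Thm. 5.1, Lemmas 5.2–5.3 and the proof of Thm. 5.1, pp. 13–16; §2.5 (threshold gates
  `t_{≥k}`); §7.1 p. 19 (use in the proof of Thm. 7.1). Read: `lit read
  doi:10.4086/toc.2025.v021a014 --pages 13-19`.
* M. Anderson, A. Dawar, *On symmetric circuits and fixed-point logics*, Theory Comput. Syst. 60
  (2017), Lemma 7 (rigidification; `CircuitReduce.lean`).
-/

noncomputable section

open scoped Classical

namespace Literature.Computability.AlgebraicComplexity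

open Finset MvPolynomial Literature.Computability.Complexity

namespace LabelledArithCircuit

variable {F : Type*} [Field F] {n : ℕ} {G : Type*} [Fintype G]
variable (Φ : LabelledArithCircuit F (Fin n × Fin n) Unit G)

/-! ### Boolean inputs: values, the value universe, fan-in -/

/-- The value of gate `g` on the `0/1` input `A`. [cite: DawarWilsenach2025, §5 (p. 13, Φ[A])] -/
def bval (A : Fin n × Fin n → Bool) (g : G) : F :=
  MvPolynomial.eval (fun ij => if A ij = true then (1 : F) else 0) (Φ.eval g)

/-- The (finite) set of all values taken by all gates on `0/1` inputs. [cite: DawarWilsenach2025, §5 (p. 14, the sets Q_v)] -/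
def vals : Finset F := univ.biUnion fun g => univ.image fun A : Fin n × Fin n → Bool => Φ.bval A g

/-- Every Boolean value of every gate lies in `vals`. [folklore] -/
theorem bval_mem_vals (A : Fin n × Fin n → Bool) (g : G) : Φ.bval A g ∈ Φ.vals :=
  Finset.mem_biUnion.2 ⟨g, mem_univ g, Finset.mem_image.2 ⟨A, mem_univ A, rfl⟩⟩

/-- The value universe as a type. [folklore] -/
abbrev Val : Type _ := ↥Φ.vals

/-- The fan-in of a gate. [folklore] -/
def fanin (g : G) : ℕ := (Φ.children g).card

/-- The maximal fan-in. [folklore] -/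
def maxFanin : ℕ := univ.sup Φ.fanin

omit [Field F] in
/-- Fan-ins are bounded by the maximal fan-in. [folklore] -/
theorem fanin_le_maxFanin (g : G) : Φ.fanin g ≤ Φ.maxFanin := Finset.le_sup (f := Φ.fanin) (mem_univ g)

/-- PROFILES: a count, for each value, of the children taking that value. [cite: DawarWilsenach2025, §5 (proof of Thm 5.1)] -/
abbrev Prof : Type _ := Φ.Val → Fin (Φ.maxFanin + 1)

/-! ### The gates of the threshold circuit -/

/-- The gates of the threshold circuit `Ψ(Φ, S)`: the constants, the negated inputs, and for every
gate `g` of `Φ` and value `c` the threshold layer `thr g c k` ("at least `k` children of `g` have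
value `c`"), its negations, the exact-count gates, the profile gates, and the INDICATOR `ind g c`
of "`g` has value `c`"; finally the output. [cite: DawarWilsenach2025, §5 (proof of Thm 5.1)] -/
inductive TGate : Type _
  | one : TGate
  | zero : TGate
  | notx (x : Fin n × Fin n) : TGate
  | thr (g : G) (c : Φ.Val) (k : Fin (Φ.maxFanin + 2)) : TGate
  | neg (g : G) (c : Φ.Val) (k : Fin (Φ.maxFanin + 1)) : TGate
  | exa (g : G) (c : Φ.Val) (k : Fin (Φ.maxFanin + 1)) : TGate
  | prof (g : G) (p : Φ.Prof) : TGate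
  | ind (g : G) (c : Φ.Val) : TGate
  | out : TGate

/-- The gate type as a sum type (for finiteness). [folklore] -/
def TGate.toSum : Φ.TGate → Unit ⊕ Unit ⊕ (Fin n × Fin n) ⊕ (G × Φ.Val × Fin (Φ.maxFanin + 2)) ⊕
    (G × Φ.Val × Fin (Φ.maxFanin + 1)) ⊕ (G × Φ.Val × Fin (Φ.maxFanin + 1)) ⊕ (G × Φ.Prof) ⊕ (G × Φ.Val) ⊕ Unit
  | .one => .inl ()
  | .zero => .inr (.inl ())
  | .notx x => .inr (.inr (.inl x))
  | .thr g c k => .inr (.inr (.inr (.inl (g, c, k))))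
  | .neg g c k => .inr (.inr (.inr (.inr (.inl (g, c, k)))))
  | .exa g c k => .inr (.inr (.inr (.inr (.inr (.inl (g, c, k))))))
  | .prof g p => .inr (.inr (.inr (.inr (.inr (.inr (.inl (g, p)))))))
  | .ind g c => .inr (.inr (.inr (.inr (.inr (.inr (.inr (.inl (g, c))))))))
  | .out => .inr (.inr (.inr (.inr (.inr (.inr (.inr (.inr ())))))))

/-- A left inverse of `TGate.toSum`. [folklore] -/
def TGate.ofSum : Unit ⊕ Unit ⊕ (Fin n × Fin n) ⊕ (G × Φ.Val × Fin (Φ.maxFanin + 2)) ⊕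
    (G × Φ.Val × Fin (Φ.maxFanin + 1)) ⊕ (G × Φ.Val × Fin (Φ.maxFanin + 1)) ⊕ (G × Φ.Prof) ⊕ (G × Φ.Val) ⊕ Unit →
    Φ.TGate
  | .inl _ => .one
  | .inr (.inl _) => .zero
  | .inr (.inr (.inl x)) => .notx x
  | .inr (.inr (.inr (.inl (g, c, k)))) => .thr g c k
  | .inr (.inr (.inr (.inr (.inl (g, c, k))))) => .neg g c k
  | .inr (.inr (.inr (.inr (.inr (.inl (g, c, k)))))) => .exa g c k
  | .inr (.inr (.inr (.inr (.inr (.inr (.inl (g, p))))))) => .prof g p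
  | .inr (.inr (.inr (.inr (.inr (.inr (.inr (.inl (g, c)))))))) => .ind g c
  | .inr (.inr (.inr (.inr (.inr (.inr (.inr (.inr _))))))) => .out

/-- `TGate.toSum` is injective. [folklore] -/
theorem TGate.toSum_injective : Function.Injective (TGate.toSum Φ) :=
  Function.LeftInverse.injective (g := TGate.ofSum Φ) fun l => by cases l <;> rfl

/-- The gate type is finite. [folklore] -/
instance TGate.fintype : Fintype Φ.TGate := Fintype.ofInjective _ (TGate.toSum_injective Φ)

variable (S : Set F)

/-- Padding with `true` constants for the threshold gate "at least `k` of `r`". [folklore] -/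
def tpad (r k : ℕ) : ℕ := r - 2 * k

/-- Padding with `false` constants for the threshold gate "at least `k` of `r`". [folklore] -/
def fpad (r k : ℕ) : ℕ := 2 * k - r

/-- The padding realises the threshold `k` by a majority gate: with `o` ones among the `r` proper
arguments, `MAJ` on `r + tpad + fpad` arguments of which `o + tpad` are ones fires iff `k ≤ o`.
[cite: DawarWilsenach2025, §2.5 (threshold gates t_{≥k})] -/
theorem maj_pad_iff (r k o : ℕ) :
    r + tpad r k + fpad r k ≤ 2 * (o + tpad r k) ↔ k ≤ o := by
  unfold tpad fpad; omega

/-- The INDICATOR WIRE of "gate `h` has value `c`": an input wire or its negation for a variable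
gate, a constant for a constant gate, the indicator gate `ind h c` otherwise.
[cite: DawarWilsenach2025, §5 (proof of Thm 5.1)] -/
def indW (h : G) (c : Φ.Val) : (Fin n × Fin n) ⊕ Φ.TGate :=
  match Φ.label h with
  | .var x => if c.1 = 1 then .inl x else if c.1 = 0 then .inr (.notx x) else .inr .zero
  | .const d => if c.1 = d then .inr .one else .inr .zero
  | .add => .inr (.ind h c)
  | .mul => .inr (.ind h c)

/-- A profile `p` is VALID for `(g, c)`: it counts `fanin g` children in total and the value of
`g` computed from these counts — the sum `∑ p(c') c'` for a `+` gate, the product `∏ c'^{p(c')}`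
for a `×` gate — is `c` (input gates have no valid profiles). [cite: DawarWilsenach2025, §5 (proof of Thm 5.1)] -/
def Valid (g : G) (c : Φ.Val) (p : Φ.Prof) : Prop :=
  (∑ c', (p c' : ℕ)) = Φ.fanin g ∧
    match Φ.label g with
    | .add => (∑ c', (p c' : ℕ) • (c'.1 : F)) = c.1
    | .mul => (∏ c', (c'.1 : F) ^ (p c' : ℕ)) = c.1
    | .var _ => False
    | .const _ => False

/-- The valid profiles of `(g, c)`. [folklore] -/
def validFS (g : G) (c : Φ.Val) : Finset Φ.Prof := univ.filter (Φ.Valid g c)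

/-- The values in `S`. [folklore] -/
def sFS : Finset Φ.Val := univ.filter fun c => c.1 ∈ S

/-- Enumeration of the children of a gate. [folklore] -/
def enumCh (g : G) : Fin (Φ.fanin g) ≃ ↥(Φ.children g) := (Φ.children g).equivFin.symm

/-- Enumeration of the value universe. [folklore] -/
def enumVal : Fin (Fintype.card Φ.Val) ≃ Φ.Val := (Fintype.equivFin Φ.Val).symm

/-- Enumeration of the valid profiles. [folklore] -/
def enumValid (g : G) (c : Φ.Val) : Fin (Φ.validFS g c).card ≃ ↥(Φ.validFS g c) :=
  (Φ.validFS g c).equivFin.symm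

/-- Enumeration of the values in `S`. [folklore] -/
def enumS : Fin (Φ.sFS S).card ≃ ↥(Φ.sFS S) := (Φ.sFS S).equivFin.symm

/-- The gate functions of the threshold circuit. [cite: DawarWilsenach2025, §5 (proof of Thm 5.1)] -/
def tfn : Φ.TGate → GateFn
  | .one => GateFn.and 0
  | .zero => GateFn.or 0
  | .notx _ => GateFn.not
  | .thr g _ k => GateFn.maj (Φ.fanin g + tpad (Φ.fanin g) k + fpad (Φ.fanin g) k)
  | .neg _ _ _ => GateFn.not
  | .exa _ _ _ => GateFn.and 2
  | .prof _ _ => GateFn.and (Fintype.card Φ.Val)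
  | .ind g c => GateFn.or (Φ.validFS g c).card
  | .out => GateFn.or (Φ.sFS S).card

/-- The wires of the threshold circuit. [cite: DawarWilsenach2025, §5 (proof of Thm 5.1)] -/
def targs : (l : Φ.TGate) → Fin (Φ.tfn S l).1 → (Fin n × Fin n) ⊕ Φ.TGate
  | .one => fun a => a.elim0
  | .zero => fun a => a.elim0
  | .notx x => fun _ => .inl x
  | .thr g c _ => Fin.append (Fin.append (fun a => Φ.indW (Φ.enumCh g a).1 c)
      (fun _ => .inr .one)) (fun _ => .inr .zero)
  | .neg g c k => fun _ => .inr (.thr g c k.succ)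
  | .exa g c k => fun a => if (a : ℕ) = 0 then .inr (.thr g c k.castSucc) else .inr (.neg g c k)
  | .prof g p => fun a => .inr (.exa g (Φ.enumVal a) (p (Φ.enumVal a)))
  | .ind g c => fun a => .inr (.prof g (Φ.enumValid g c a).1)
  | .out => fun a => Φ.indW (Φ.output ()) (Φ.enumS S a).1

/-- The height of a gate of `Φ`. [folklore] -/
def gheight : G → ℕ :=
  Φ.wf.fix fun g rec => (Φ.children g).attach.sup fun h => rec h.1 h.2 + 1

omit [Field F] [Fintype G] in
/-- The defining equation of `gheight`. [folklore] -/
theorem gheight_eq (g : G) : Φ.gheight g = (Φ.children g).sup fun h => Φ.gheight h + 1 := by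
  show Φ.wf.fix _ g = _
  rw [WellFounded.fix_eq]
  exact Finset.sup_attach (Φ.children g) (f := fun h => Φ.gheight h + 1)

omit [Field F] [Fintype G] in
/-- Children have smaller height. [folklore] -/
theorem gheight_lt {g h : G} (hh : h ∈ Φ.children g) : Φ.gheight h < Φ.gheight g := by
  rw [Φ.gheight_eq g]
  exact Finset.le_sup (f := fun h => Φ.gheight h + 1) hh

/-- Rank of a gate of the threshold circuit (for acyclicity). [folklore] -/
def trank : Φ.TGate → ℕ
  | .one => 0
  | .zero => 0
  | .notx _ => 0
  | .thr g _ _ => 10 * Φ.gheight g + 1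
  | .neg g _ _ => 10 * Φ.gheight g + 2
  | .exa g _ _ => 10 * Φ.gheight g + 3
  | .prof g _ => 10 * Φ.gheight g + 4
  | .ind g _ => 10 * Φ.gheight g + 5
  | .out => 10 * Φ.gheight (Φ.output ()) + 6

/-- The indicator wire of `h`, if a gate, has rank at most `10 · height h + 5`. [folklore] -/
theorem trank_indW {h : G} {c : Φ.Val} {m : Φ.TGate} (hm : Φ.indW h c = .inr m) :
    Φ.trank m ≤ 10 * Φ.gheight h + 5 := by
  unfold indW at hm
  split at hm
  · split_ifs at hm with h1 h2
    · cases hm; exact Nat.zero_le _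
    · cases hm; exact Nat.zero_le _
  · split_ifs at hm
    · cases hm; exact Nat.zero_le _
    · cases hm; exact Nat.zero_le _
  · cases hm; exact le_rfl
  · cases hm; exact le_rfl

/-- A value of `Fin.append u v` is a value of `u` or a value of `v`. [folklore] -/
theorem fin_append_cases {α : Type*} {a b : ℕ} (u : Fin a → α) (v : Fin b → α) (i : Fin (a + b)) :
    (∃ j, Fin.append u v i = u j) ∨ ∃ j, Fin.append u v i = v j := by
  induction i using Fin.addCases with
  | left j => exact Or.inl ⟨j, Fin.append_left u v j⟩
  | right j => exact Or.inr ⟨j, Fin.append_right u v j⟩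

/-- **The threshold circuit `Ψ(Φ, S)` as a DAG.** [cite: DawarWilsenach2025, Thm 5.1 (proof, §5)] -/
def tdag : GateDAG (Fin n × Fin n) Φ.TGate where
  fn := Φ.tfn S
  args := Φ.targs S
  out := .inr .out
  wf := by
    refine Subrelation.wf ?_ (InvImage.wf Φ.trank wellFounded_lt)
    rintro m l ⟨a, ha⟩
    show Φ.trank m < Φ.trank l
    cases l with
    | one => exact a.elim0
    | zero => exact a.elim0
    | notx x => exact absurd ha Sum.inl_ne_inr
    | thr g c k =>
      change Fin.append (Fin.append (fun a => Φ.indW (Φ.enumCh g a).1 c)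
        (fun _ => .inr .one)) (fun _ => .inr .zero) a = .inr m at ha
      rcases fin_append_cases _ _ a with ⟨j, hj⟩ | ⟨j, hj⟩
      · rw [hj] at ha
        rcases fin_append_cases _ _ j with ⟨j', hj'⟩ | ⟨j', hj'⟩
        · rw [hj'] at ha
          have h1 := Φ.trank_indW ha
          have h2 := Φ.gheight_lt (Φ.enumCh g j').2
          show Φ.trank m < 10 * Φ.gheight g + 1
          omega
        · rw [hj'] at ha; cases ha; exact Nat.succ_pos _
      · rw [hj] at ha; cases ha; exact Nat.succ_pos _
    | neg g c k => cases ha; show 10 * _ + 1 < 10 * _ + 2; omega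
    | exa g c k =>
      change (if (a : ℕ) = 0 then Sum.inr (.thr g c k.castSucc) else Sum.inr (.neg g c k)) = .inr m at ha
      split_ifs at ha
      · cases ha; show 10 * _ + 1 < 10 * _ + 3; omega
      · cases ha; show 10 * _ + 2 < 10 * _ + 3; omega
    | prof g p => cases ha; show 10 * _ + 3 < 10 * _ + 4; omega
    | ind g c => cases ha; show 10 * _ + 4 < 10 * _ + 5; omega
    | out =>
      have h1 := Φ.trank_indW ha
      show Φ.trank m < 10 * Φ.gheight (Φ.output ()) + 6
      omega

/-! ### Semantics of the threshold circuit -/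

section Semantics

variable (A : Fin n × Fin n → Bool)

/-- The number of children of `g` with value `c` on input `A`. [cite: DawarWilsenach2025, §5 (proof of Thm 5.1)] -/
def cnt (g : G) (c : Φ.Val) : ℕ := ((Φ.children g).filter fun h => Φ.bval A h = c.1).card

/-- Counts are bounded by the fan-in. [folklore] -/
theorem cnt_le_fanin (g : G) (c : Φ.Val) : Φ.cnt A g c ≤ Φ.fanin g := Finset.card_filter_le _ _

/-- `∧ₖ` applied. [folklore] -/
theorem and_apply (k : ℕ) (v : Fin k → Bool) : (GateFn.and k).2 v = decide (∀ i, v i = true) := rfl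

/-- `∨ₖ` applied. [folklore] -/
theorem or_apply (k : ℕ) (v : Fin k → Bool) : (GateFn.or k).2 v = decide (∃ i, v i = true) := rfl

/-- `MAJₖ` applied. [folklore] -/
theorem maj_apply (k : ℕ) (v : Fin k → Bool) : (GateFn.maj k).2 v = decide (k ≤ 2 * GateFn.numOnes v) := rfl

/-- `¬` applied. [folklore] -/
theorem not_apply (v : Fin 1 → Bool) : GateFn.not.2 v = !(v 0) := rfl

/-- Number of ones of an appended tuple. [folklore] -/
theorem numOnes_append {a b : ℕ} (u : Fin a → Bool) (v : Fin b → Bool) :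
    GateFn.numOnes (Fin.append u v) = GateFn.numOnes u + GateFn.numOnes v := by
  unfold GateFn.numOnes
  rw [Finset.card_filter, Finset.card_filter, Finset.card_filter, Fin.sum_univ_add]
  simp only [Fin.append_left, Fin.append_right]

/-- Post-composition distributes over `Fin.append`. [folklore] -/
theorem comp_fin_append {α β : Type*} {a b : ℕ} (u : Fin a → α) (v : Fin b → α) (f : α → β) :
    (fun i => f (Fin.append u v i)) = Fin.append (f ∘ u) (f ∘ v) := by
  funext i
  induction i using Fin.addCases with
  | left j => simp only [Fin.append_left, Function.comp_apply]
  | right j => simp only [Fin.append_right, Function.comp_apply]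

/-- Post-composition distributes over `Fin.append` (composition form). [folklore] -/
theorem comp_fin_append' {α β : Type*} {a b : ℕ} (u : Fin a → α) (v : Fin b → α) (f : α → β) :
    f ∘ Fin.append u v = Fin.append (f ∘ u) (f ∘ v) :=
  comp_fin_append u v f

/-- Number of ones of a constant tuple. [folklore] -/
theorem numOnes_const (a : ℕ) (b : Bool) : GateFn.numOnes (fun _ : Fin a => b) = if b then a else 0 := by
  unfold GateFn.numOnes
  cases b <;> simp

/-- Number of ones of a tuple of decisions is the number of true instances. [folklore] -/
theorem numOnes_decide {a : ℕ} (P : Fin a → Prop) :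
    GateFn.numOnes (fun i => decide (P i)) = (univ.filter P).card := by
  unfold GateFn.numOnes
  congr 1
  ext i
  simp

local notation "Ψ" => Φ.tdag S

/-- The value of the constant `one`. [folklore] -/
theorem val_one : (Ψ).val A .one = true := by
  rw [GateDAG.val_eq]; show (GateFn.and 0).2 _ = true; rw [and_apply]; simp

/-- The value of the constant `zero`. [folklore] -/
theorem val_zero : (Ψ).val A .zero = false := by
  rw [GateDAG.val_eq]; show (GateFn.or 0).2 _ = false; rw [or_apply]; simp

/-- The value of a negated input. [folklore] -/
theorem val_notx (x : Fin n × Fin n) : (Ψ).val A (.notx x) = !(A x) := by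
  rw [GateDAG.val_eq]; rfl

omit [Fintype G] in
/-- The value of a variable gate of `Φ` on a `0/1` input. [folklore] -/
theorem bval_of_label_var {h : G} {x : Fin n × Fin n} (hl : Φ.label h = .var x) :
    Φ.bval A h = if A x = true then 1 else 0 := by
  rw [bval, Φ.eval_of_label_var hl, MvPolynomial.eval_X]

omit [Fintype G] in
/-- The value of a constant gate of `Φ`. [folklore] -/
theorem bval_of_label_const {h : G} {d : F} (hl : Φ.label h = .const d) : Φ.bval A h = d := by
  rw [bval, Φ.eval_of_label_const hl, MvPolynomial.eval_C]

omit [Fintype G] in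
/-- The value of a `+` gate of `Φ` on a `0/1` input. [folklore] -/
theorem bval_of_label_add {g : G} (hl : Φ.label g = .add) : Φ.bval A g = ∑ h ∈ Φ.children g, Φ.bval A h := by
  rw [bval, Φ.eval_of_label_add hl, map_sum]; rfl

omit [Fintype G] in
/-- The value of a `×` gate of `Φ` on a `0/1` input. [folklore] -/
theorem bval_of_label_mul {g : G} (hl : Φ.label g = .mul) : Φ.bval A g = ∏ h ∈ Φ.children g, Φ.bval A h := by
  rw [bval, Φ.eval_of_label_mul hl, map_prod]; rfl

/-- **The indicator wire of an INPUT gate is correct.** [cite: DawarWilsenach2025, §5 (proof of Thm 5.1, input gates)] -/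
theorem wire_indW_of_isInput {h : G} (hin : (Φ.label h).IsInput) (c : Φ.Val) :
    GateDAG.wire A ((Ψ).val A) (Φ.indW h c) = decide (Φ.bval A h = c.1) := by
  unfold indW
  rcases hl : Φ.label h with x | d | _ | _
  · simp only
    rw [Φ.bval_of_label_var A hl]
    by_cases h1 : c.1 = 1
    · rw [if_pos h1, GateDAG.wire_inl, h1]
      cases A x <;> simp
    · rw [if_neg h1]
      by_cases h0 : c.1 = 0
      · rw [if_pos h0, GateDAG.wire_inr, val_notx, h0]
        cases A x <;> simp
      · rw [if_neg h0, GateDAG.wire_inr, val_zero]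
        symm; rw [decide_eq_false_iff_not]
        cases A x <;> simp [Ne.symm h1, Ne.symm h0]
  · simp only
    rw [Φ.bval_of_label_const A hl]
    split_ifs with h1
    · rw [GateDAG.wire_inr, val_one, h1]; simp
    · rw [GateDAG.wire_inr, val_zero]; symm; rw [decide_eq_false_iff_not]; exact Ne.symm h1
  · rw [hl] at hin; exact absurd hin CircuitLabel.not_isInput_add
  · rw [hl] at hin; exact absurd hin CircuitLabel.not_isInput_mul

/-- **The threshold layer**: given correct indicator wires of the children, `thr g c k` fires iff
at least `k` children of `g` have value `c`. [cite: DawarWilsenach2025, §5 (proof of Thm 5.1)] -/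
theorem val_thr {g : G} (ih : ∀ h ∈ Φ.children g, ∀ c, GateDAG.wire A ((Ψ).val A) (Φ.indW h c) = decide (Φ.bval A h = c.1))
    (c : Φ.Val) (k : Fin (Φ.maxFanin + 2)) :
    (Ψ).val A (.thr g c k) = decide ((k : ℕ) ≤ Φ.cnt A g c) := by
  rw [GateDAG.val_eq]
  show (GateFn.maj _).2 (fun a : Fin (Φ.fanin g + tpad (Φ.fanin g) k + fpad (Φ.fanin g) k) =>
    GateDAG.wire A ((Ψ).val A) (Fin.append (Fin.append
    (fun a => Φ.indW (Φ.enumCh g a).1 c) (fun _ => Sum.inr .one)) (fun _ => Sum.inr .zero) a)) = _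
  rw [maj_apply, comp_fin_append, numOnes_append, comp_fin_append', numOnes_append]
  have h1 : (GateDAG.wire A ((Ψ).val A) ∘ fun _ : Fin (tpad (Φ.fanin g) k) => (Sum.inr TGate.one : (Fin n × Fin n) ⊕ Φ.TGate)) =
      fun _ => true := by funext a; exact Φ.val_one S A
  have h2 : (GateDAG.wire A ((Ψ).val A) ∘ fun _ : Fin (fpad (Φ.fanin g) k) => (Sum.inr TGate.zero : (Fin n × Fin n) ⊕ Φ.TGate)) =
      fun _ => false := by funext a; exact Φ.val_zero S A
  have h3 : (GateDAG.wire A ((Ψ).val A) ∘ fun a => Φ.indW (Φ.enumCh g a).1 c) =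
      fun a => decide (Φ.bval A (Φ.enumCh g a).1 = c.1) := by
    funext a; exact ih _ (Φ.enumCh g a).2 c
  have hcnt : (univ.filter fun a => Φ.bval A (Φ.enumCh g a).1 = c.1).card = Φ.cnt A g c := by
    unfold cnt
    rw [Finset.card_equiv (Φ.enumCh g) (t := univ.filter fun h : ↥(Φ.children g) => Φ.bval A h.1 = c.1)
      (fun a => by simp), Finset.univ_eq_attach, Finset.filter_attach (fun h => Φ.bval A h = c.1),
      Finset.card_map, Finset.card_attach]
  rw [h1, h2, h3, numOnes_const, numOnes_const, numOnes_decide, hcnt, if_pos rfl]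
  simp only [Bool.false_eq_true, ↓reduceIte, add_zero]
  rw [decide_eq_decide]
  exact maj_pad_iff _ _ _

/-- The negated threshold gate. [folklore] -/
theorem val_neg (g : G) (c : Φ.Val) (k : Fin (Φ.maxFanin + 1)) :
    (Ψ).val A (.neg g c k) = !((Ψ).val A (.thr g c k.succ)) := by
  rw [GateDAG.val_eq]; rfl

/-- `∧₂` applied. [folklore] -/
theorem and_two_apply (v : Fin 2 → Bool) : (GateFn.and 2).2 v = (v 0 && v 1) := by
  rw [and_apply]
  cases h0 : v 0 <;> cases h1 : v 1 <;> simp [Fin.forall_fin_two, h0, h1]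

/-- The exact-count gate. [folklore] -/
theorem val_exa (g : G) (c : Φ.Val) (k : Fin (Φ.maxFanin + 1)) :
    (Ψ).val A (.exa g c k) = ((Ψ).val A (.thr g c k.castSucc) && !((Ψ).val A (.thr g c k.succ))) := by
  rw [GateDAG.val_eq]
  show (GateFn.and 2).2 (fun a : Fin 2 => GateDAG.wire A ((Ψ).val A)
    (if (a : ℕ) = 0 then Sum.inr (.thr g c k.castSucc) else Sum.inr (.neg g c k))) = _
  rw [and_two_apply]
  simp only [Fin.val_zero, ↓reduceIte, Fin.val_one, one_ne_zero, GateDAG.wire_inr, val_neg]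

/-- **The exact-count gate is correct**, given correct indicator wires of the children. [cite: DawarWilsenach2025, §5 (proof of Thm 5.1)] -/
theorem val_exa_eq {g : G} (ih : ∀ h ∈ Φ.children g, ∀ c, GateDAG.wire A ((Ψ).val A) (Φ.indW h c) = decide (Φ.bval A h = c.1))
    (c : Φ.Val) (k : Fin (Φ.maxFanin + 1)) :
    (Ψ).val A (.exa g c k) = decide (Φ.cnt A g c = k) := by
  rw [val_exa, Φ.val_thr S A ih, Φ.val_thr S A ih]
  have e1 : ((k.castSucc : Fin (Φ.maxFanin + 2)) : ℕ) = k := rfl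
  have e2 : ((k.succ : Fin (Φ.maxFanin + 2)) : ℕ) = k + 1 := rfl
  rw [e1, e2]
  rcases lt_trichotomy (Φ.cnt A g c) k with h | h | h
  · have h1 : ¬ ((k : ℕ) ≤ Φ.cnt A g c) := by omega
    have h3 : ¬ (Φ.cnt A g c = k) := by omega
    simp [h1, h3]
  · have h1 : (k : ℕ) ≤ Φ.cnt A g c := h.ge
    have h2 : ¬ ((k : ℕ) + 1 ≤ Φ.cnt A g c) := by omega
    rw [decide_eq_true h1, decide_eq_false h2, decide_eq_true h]; rfl
  · have h1 : (k : ℕ) ≤ Φ.cnt A g c := by omega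
    have h2 : (k : ℕ) + 1 ≤ Φ.cnt A g c := by omega
    have h3 : ¬ (Φ.cnt A g c = k) := by omega
    simp [h1, h2, h3]

/-- **The profile gate is correct.** [cite: DawarWilsenach2025, §5 (proof of Thm 5.1)] -/
theorem val_prof {g : G} (ih : ∀ h ∈ Φ.children g, ∀ c, GateDAG.wire A ((Ψ).val A) (Φ.indW h c) = decide (Φ.bval A h = c.1))
    (p : Φ.Prof) : (Ψ).val A (.prof g p) = decide (∀ c, Φ.cnt A g c = p c) := by
  rw [GateDAG.val_eq]
  show (GateFn.and _).2 (fun a => (Ψ).val A (.exa g (Φ.enumVal a) (p (Φ.enumVal a)))) = _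
  rw [and_apply]
  simp only [Φ.val_exa_eq S A ih, decide_eq_true_eq]
  rw [decide_eq_decide]
  exact ⟨fun h c => by simpa using h (Φ.enumVal.symm c), fun h a => h _⟩

/-- **The indicator gate, as a formula on profiles.** [cite: DawarWilsenach2025, §5 (proof of Thm 5.1)] -/
theorem val_ind {g : G} (ih : ∀ h ∈ Φ.children g, ∀ c, GateDAG.wire A ((Ψ).val A) (Φ.indW h c) = decide (Φ.bval A h = c.1))
    (c : Φ.Val) : (Ψ).val A (.ind g c) = decide (∃ p ∈ Φ.validFS g c, ∀ c', Φ.cnt A g c' = p c') := by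
  rw [GateDAG.val_eq]
  show (GateFn.or _).2 (fun a => (Ψ).val A (.prof g (Φ.enumValid g c a).1)) = _
  rw [or_apply]
  simp only [Φ.val_prof S A ih, decide_eq_true_eq]
  rw [decide_eq_decide]
  constructor
  · rintro ⟨a, ha⟩; exact ⟨_, (Φ.enumValid g c a).2, ha⟩
  · rintro ⟨p, hp, h⟩
    refine ⟨(Φ.enumValid g c).symm ⟨p, hp⟩, ?_⟩
    simpa using h

/-- The canonical profile: the actual counts. [folklore] -/
def cntProf (g : G) : Φ.Prof := fun c => ⟨Φ.cnt A g c, Nat.lt_succ_of_le ((Φ.cnt_le_fanin A g c).trans (Φ.fanin_le_maxFanin g))⟩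

/-- The counts sum to the fan-in. [folklore] -/
theorem sum_cnt (g : G) : (∑ c, Φ.cnt A g c) = Φ.fanin g := by
  unfold fanin
  rw [Finset.card_eq_sum_card_fiberwise (f := fun h => Φ.bval A h) (s := Φ.children g) (t := Φ.vals)
    (fun h _ => Φ.bval_mem_vals A h)]
  exact Finset.sum_coe_sort Φ.vals (fun b => ((Φ.children g).filter fun h => Φ.bval A h = b).card)

/-- The sum of the children values, grouped by value. [folklore] -/
theorem sum_cnt_smul (g : G) : (∑ c, Φ.cnt A g c • (c.1 : F)) = ∑ h ∈ Φ.children g, Φ.bval A h := by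
  rw [← Finset.sum_fiberwise_of_maps_to (s := Φ.children g) (t := Φ.vals) (g := fun h => Φ.bval A h)
    (fun h _ => Φ.bval_mem_vals A h) (fun h => Φ.bval A h)]
  rw [← Finset.sum_coe_sort Φ.vals]
  refine Finset.sum_congr rfl fun c _ => ?_
  unfold cnt
  rw [← Finset.sum_const]
  exact Finset.sum_congr rfl fun h hh => ((Finset.mem_filter.1 hh).2).symm

/-- The product of the children values, grouped by value. [folklore] -/
theorem prod_pow_cnt (g : G) : (∏ c, (c.1 : F) ^ Φ.cnt A g c) = ∏ h ∈ Φ.children g, Φ.bval A h := by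
  rw [← Finset.prod_fiberwise_of_maps_to (s := Φ.children g) (t := Φ.vals) (g := fun h => Φ.bval A h)
    (fun h _ => Φ.bval_mem_vals A h) (fun h => Φ.bval A h)]
  rw [← Finset.prod_coe_sort Φ.vals]
  refine Finset.prod_congr rfl fun c _ => ?_
  unfold cnt
  rw [← Finset.prod_const]
  exact Finset.prod_congr rfl fun h hh => ((Finset.mem_filter.1 hh).2).symm

/-- **The profile formula computes the value of an internal gate**: some valid profile matches
the actual counts iff `g` has value `c`. [cite: DawarWilsenach2025, §5 (proof of Thm 5.1)] -/
theorem exists_valid_iff {g : G} (hg : ¬ (Φ.label g).IsInput) (c : Φ.Val) :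
    (∃ p ∈ Φ.validFS g c, ∀ c', Φ.cnt A g c' = p c') ↔ Φ.bval A g = c.1 := by
  have key : Φ.Valid g c (Φ.cntProf A g) ↔ Φ.bval A g = c.1 := by
    unfold Valid
    simp only [cntProf, Φ.sum_cnt A g, true_and]
    rcases hl : Φ.label g with x | d | _ | _
    · rw [hl] at hg; exact absurd (CircuitLabel.isInput_var x) hg
    · rw [hl] at hg; exact absurd (CircuitLabel.isInput_const d) hg
    · simp only; rw [Φ.sum_cnt_smul A g, Φ.bval_of_label_add A hl]
    · simp only; rw [Φ.prod_pow_cnt A g, Φ.bval_of_label_mul A hl]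
  constructor
  · rintro ⟨p, hp, h⟩
    have : p = Φ.cntProf A g := funext fun c' => Fin.ext (h c').symm
    rw [validFS, Finset.mem_filter] at hp
    rw [this] at hp
    exact key.1 hp.2
  · intro h
    exact ⟨Φ.cntProf A g, Finset.mem_filter.2 ⟨mem_univ _, key.2 h⟩, fun c' => rfl⟩

/-- **Every indicator wire is correct**: the wire `indW h c` carries `[val_h(A) = c]`.
[cite: DawarWilsenach2025, §5 (proof of Thm 5.1: "Ψ_v evaluates to 1 iff v evaluates to c")] -/
theorem wire_indW (h : G) (c : Φ.Val) :
    GateDAG.wire A ((Ψ).val A) (Φ.indW h c) = decide (Φ.bval A h = c.1) := by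
  induction h using Φ.wf.induction generalizing c with
  | _ h ih =>
    by_cases hin : (Φ.label h).IsInput
    · exact Φ.wire_indW_of_isInput S A hin c
    · have hw : Φ.indW h c = Sum.inr (.ind h c) := by
        unfold indW
        rcases hl : Φ.label h with x | d | _ | _
        · rw [hl] at hin; exact absurd (CircuitLabel.isInput_var x) hin
        · rw [hl] at hin; exact absurd (CircuitLabel.isInput_const d) hin
        · rfl
        · rfl
      rw [hw, GateDAG.wire_inr, Φ.val_ind S A (fun h' hh' c' => ih h' hh' c'), decide_eq_decide]
      exact Φ.exists_valid_iff A hin c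

/-- **The threshold circuit decides `Φ[A] ∈ S`.** [cite: DawarWilsenach2025, Thm 5.1] -/
theorem evalOut_tdag : (Ψ).evalOut A = decide (Φ.bval A (Φ.output ()) ∈ S) := by
  rw [GateDAG.evalOut]
  show (Ψ).val A .out = _
  rw [GateDAG.val_eq]
  show (GateFn.or _).2 (fun a => GateDAG.wire A ((Ψ).val A) (Φ.indW (Φ.output ()) (Φ.enumS S a).1)) = _
  rw [or_apply]
  simp only [Φ.wire_indW S A, decide_eq_true_eq]
  rw [decide_eq_decide]
  constructor
  · rintro ⟨a, ha⟩
    rw [ha]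
    exact (Finset.mem_filter.1 (Φ.enumS S a).2).2
  · intro h
    refine ⟨(Φ.enumS S).symm ⟨⟨Φ.bval A (Φ.output ()), Φ.bval_mem_vals A _⟩,
      Finset.mem_filter.2 ⟨mem_univ _, h⟩⟩, ?_⟩
    simp

end Semantics

/-! ### Automorphisms of `Φ` induce automorphisms of the threshold circuit -/

section Equivariance

variable {ρ : Equiv.Perm (Fin n)} {τ : Equiv.Perm G}

/-- The action of an automorphism `τ` of `Φ` (over `ρ`) on the gates of the threshold circuit:
`g ↦ τ g` in every layer, `x ↦ ρ • x` on negated inputs, all data (values, counts, profiles)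
fixed. [cite: DawarWilsenach2025, §5 (proof of Thm 5.1, "π extends to an automorphism of Ψ")] -/
def tmap (ρ : Equiv.Perm (Fin n)) (τ : Equiv.Perm G) : Φ.TGate → Φ.TGate
  | .one => .one
  | .zero => .zero
  | .notx x => .notx (ρ • x)
  | .thr g c k => .thr (τ g) c k
  | .neg g c k => .neg (τ g) c k
  | .exa g c k => .exa (τ g) c k
  | .prof g p => .prof (τ g) p
  | .ind g c => .ind (τ g) c
  | .out => .out

/-- `tmap` of inverses is inverse to `tmap`. [folklore] -/
theorem tmap_tmap_symm (ρ : Equiv.Perm (Fin n)) (τ : Equiv.Perm G) (l : Φ.TGate) :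
    Φ.tmap ρ τ (Φ.tmap ρ⁻¹ τ⁻¹ l) = l := by
  cases l <;> simp [tmap]

/-- The action on the gates of the threshold circuit as a permutation. [folklore] -/
def tperm (ρ : Equiv.Perm (Fin n)) (τ : Equiv.Perm G) : Equiv.Perm Φ.TGate where
  toFun := Φ.tmap ρ τ
  invFun := Φ.tmap ρ⁻¹ τ⁻¹
  left_inv l := by
    have := Φ.tmap_tmap_symm ρ⁻¹ τ⁻¹ l
    rwa [inv_inv, inv_inv] at this
  right_inv l := Φ.tmap_tmap_symm ρ τ l

/-- `tperm` applied. [folklore] -/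
@[simp] theorem tperm_apply (ρ : Equiv.Perm (Fin n)) (τ : Equiv.Perm G) (l : Φ.TGate) :
    Φ.tperm ρ τ l = Φ.tmap ρ τ l := rfl

/-- The diagonal action of `ρ` on matrix inputs. [cite: DawarWilsenach2025, §3.2 (square-symmetric)] -/
def diagAct (ρ : Equiv.Perm (Fin n)) : Fin n × Fin n → Fin n × Fin n := fun x => ρ • x

/-- The diagonal action explicitly. [folklore] -/
theorem diagAct_apply (ρ : Equiv.Perm (Fin n)) (x : Fin n × Fin n) : diagAct ρ x = (ρ x.1, ρ x.2) := rfl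

variable (hτ : Φ.IsAutomorphismExtending ρ τ)
include hτ

omit [Field F] [Fintype G] in
/-- Automorphisms preserve fan-in. [folklore] -/
theorem fanin_map (g : G) : Φ.fanin (τ g) = Φ.fanin g := by
  unfold fanin; rw [hτ.children_apply, Finset.card_map]

omit [Field F] [Fintype G] in
/-- Automorphisms fix the output gate (one output). [folklore] -/
theorem map_output : τ (Φ.output ()) = Φ.output () := by
  have := hτ.output_smul ()
  exact this.symm

/-- Automorphisms preserve validity of profiles. [folklore] -/
theorem valid_map (g : G) (c : Φ.Val) (p : Φ.Prof) : Φ.Valid (τ g) c p ↔ Φ.Valid g c p := by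
  unfold Valid
  rw [Φ.fanin_map hτ, hτ.label_apply]
  rcases Φ.label g with x | d | _ | _ <;> simp

/-- Automorphisms preserve the sets of valid profiles. [folklore] -/
theorem validFS_map (g : G) (c : Φ.Val) : Φ.validFS (τ g) c = Φ.validFS g c := by
  unfold validFS
  exact Finset.filter_congr fun p _ => Φ.valid_map hτ g c p

/-- **Indicator wires are equivariant.** [cite: DawarWilsenach2025, §5 (proof of Thm 5.1)] -/
theorem map_indW (h : G) (c : Φ.Val) :
    Sum.map (diagAct ρ) (Φ.tperm ρ τ) (Φ.indW h c) = Φ.indW (τ h) c := by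
  unfold indW
  rw [hτ.label_apply]
  rcases Φ.label h with x | d | _ | _
  · simp only [CircuitLabel.smul_var]
    split_ifs <;> rfl
  · simp only [CircuitLabel.smul_const]
    split_ifs <;> rfl
  · rfl
  · rfl

/-- The multiset of indicator wires of the children is equivariant. [folklore] -/
theorem map_children_indW (g : G) (c : Φ.Val) :
    ((List.ofFn fun a => Φ.indW (Φ.enumCh (τ g) a).1 c : List _) : Multiset ((Fin n × Fin n) ⊕ Φ.TGate)) =
      (List.ofFn fun a => Φ.indW (τ (Φ.enumCh g a).1) c : List _) := by
  rw [← Fin.univ_val_map, ← Fin.univ_val_map]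
  have h1 : (fun a => Φ.indW (Φ.enumCh (τ g) a).1 c) = (fun h => Φ.indW h c) ∘ Subtype.val ∘ Φ.enumCh (τ g) := rfl
  have h2 : (fun a => Φ.indW (τ (Φ.enumCh g a).1) c) = (fun h => Φ.indW h c) ∘ τ ∘ Subtype.val ∘ Φ.enumCh g := rfl
  have eL : Multiset.map (Subtype.val ∘ ⇑(Φ.enumCh (τ g))) univ.val = (Φ.children (τ g)).val := by
    rw [← Multiset.map_map, Multiset.map_univ_val_equiv, univ_val_map_coe_finset]
  have eR : Multiset.map (⇑τ ∘ Subtype.val ∘ ⇑(Φ.enumCh g)) univ.val = (Φ.children (τ g)).val := by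
    rw [show (⇑τ ∘ Subtype.val ∘ ⇑(Φ.enumCh g)) = ⇑τ ∘ (Subtype.val ∘ ⇑(Φ.enumCh g)) from rfl,
      ← Multiset.map_map, ← Multiset.map_map, Multiset.map_univ_val_equiv, univ_val_map_coe_finset,
      hτ.children_apply, Finset.map_val]
    rfl
  rw [h1, h2, ← Multiset.map_map, ← Multiset.map_map (fun h => Φ.indW h c), eL, eR]

/-- **An automorphism of `Φ` over `ρ` induces an automorphism of the threshold circuit over the
diagonal action of `ρ`.** [cite: DawarWilsenach2025, §5 (proof of Thm 5.1, "Ψ is a Γ-symmetric threshold circuit")] -/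
theorem isAut_tdag : (Φ.tdag S).IsAut (diagAct ρ) (Φ.tperm ρ τ) := by
  refine ⟨rfl, ?_, ?_⟩
  · -- gate functions
    rintro (_ | _ | x | ⟨g, c, k⟩ | ⟨g, c, k⟩ | ⟨g, c, k⟩ | ⟨g, p⟩ | ⟨g, c⟩ | _) <;>
      simp only [tperm_apply, tmap] <;> try rfl
    · show GateFn.maj _ = GateFn.maj _; rw [Φ.fanin_map hτ]
    · show GateFn.or _ = GateFn.or _; rw [Φ.validFS_map hτ]
  · -- argument lists
    rintro (_ | _ | x | ⟨g, c, k⟩ | ⟨g, c, k⟩ | ⟨g, c, k⟩ | ⟨g, p⟩ | ⟨g, c⟩ | _)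
    · exact List.Perm.refl _
    · exact List.Perm.refl _
    · exact List.Perm.refl _
    · -- threshold layer: the children are permuted
      simp only [tperm_apply, tmap]
      change (List.ofFn (Fin.append (Fin.append (fun a => Φ.indW (Φ.enumCh (τ g) a).1 c)
        (fun _ => Sum.inr .one)) (fun _ => Sum.inr .zero))).Perm
        ((List.ofFn (Fin.append (Fin.append (fun a => Φ.indW (Φ.enumCh g a).1 c)
        (fun _ => Sum.inr .one)) (fun _ => Sum.inr .zero))).map (Sum.map (diagAct ρ) (Φ.tperm ρ τ)))
      rw [List.map_ofFn, comp_fin_append', comp_fin_append', List.ofFn_fin_append, List.ofFn_fin_append,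
        List.ofFn_fin_append, List.ofFn_fin_append]
      have hmid : (List.ofFn fun a => Φ.indW (Φ.enumCh (τ g) a).1 c).Perm
          (List.ofFn fun a => Φ.indW (τ (Φ.enumCh g a).1) c) := by
        rw [← Multiset.coe_eq_coe]; exact Φ.map_children_indW hτ g c
      have hfun : (Sum.map (diagAct ρ) (Φ.tperm ρ τ) ∘ fun a => Φ.indW (Φ.enumCh g a).1 c) =
          fun a => Φ.indW (τ (Φ.enumCh g a).1) c := by
        funext a; exact Φ.map_indW hτ _ _
      rw [hfun]
      simp only [Function.comp_def, Sum.map_inr, tperm_apply, tmap, List.ofFn_const]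
      rw [show tpad (Φ.fanin (τ g)) k = tpad (Φ.fanin g) k by rw [Φ.fanin_map hτ],
        show fpad (Φ.fanin (τ g)) k = fpad (Φ.fanin g) k by rw [Φ.fanin_map hτ]]
      exact (hmid.append_right _).append_right _
    · apply List.Perm.of_eq; rw [List.map_ofFn]; rfl
    · simp only [tperm_apply, tmap]
      apply List.Perm.of_eq
      change List.ofFn (fun a : Fin 2 => if (a : ℕ) = 0 then (Sum.inr (.thr (τ g) c k.castSucc) : (Fin n × Fin n) ⊕ Φ.TGate)
        else Sum.inr (.neg (τ g) c k)) = (List.ofFn (fun a : Fin 2 => if (a : ℕ) = 0 then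
        (Sum.inr (.thr g c k.castSucc) : (Fin n × Fin n) ⊕ Φ.TGate) else Sum.inr (.neg g c k))).map _
      rw [List.map_ofFn]
      congr 1
      funext a
      simp only [Function.comp_apply]
      split_ifs <;> rfl
    · apply List.Perm.of_eq; rw [List.map_ofFn]; rfl
    · -- indicator: the valid profiles coincide
      rw [← Multiset.coe_eq_coe, ← Multiset.map_coe]
      have eL : ((List.ofFn ((Φ.tdag S).args (Φ.tperm ρ τ (.ind g c))) : List _) : Multiset ((Fin n × Fin n) ⊕ Φ.TGate)) =
          (Φ.validFS (τ g) c).val.map (fun p => Sum.inr (.prof (τ g) p)) := by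
        rw [← univ_val_map_coe_finset (Φ.validFS (τ g) c), Multiset.map_map,
          ← Multiset.map_univ_val_equiv (Φ.enumValid (τ g) c), Multiset.map_map, ← Fin.univ_val_map]
        rfl
      have eR : Multiset.map (Sum.map (diagAct ρ) (Φ.tperm ρ τ))
          ((List.ofFn ((Φ.tdag S).args (.ind g c)) : List _) : Multiset ((Fin n × Fin n) ⊕ Φ.TGate)) =
          (Φ.validFS g c).val.map (fun p => Sum.inr (.prof (τ g) p)) := by
        rw [Multiset.map_coe, List.map_ofFn, ← Fin.univ_val_map, ← univ_val_map_coe_finset (Φ.validFS g c),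
          Multiset.map_map, ← Multiset.map_univ_val_equiv (Φ.enumValid g c), Multiset.map_map]
        rfl
      rw [eL, eR, Φ.validFS_map hτ]
    · -- output: fixed
      apply List.Perm.of_eq
      change List.ofFn (fun a => Φ.indW (Φ.output ()) (Φ.enumS S a).1) =
        (List.ofFn (fun a => Φ.indW (Φ.output ()) (Φ.enumS S a).1)).map _
      rw [List.map_ofFn]
      congr 1
      funext a
      simp only [Function.comp_apply]
      rw [Φ.map_indW hτ, Φ.map_output hτ]

end Equivariance

/-! ### The gate functions are threshold-basis functions -/

/-- `∧ₖ ∈ tcBasis`. [folklore] -/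
theorem and_mem_tcBasis (k : ℕ) : GateFn.and k ∈ tcBasis :=
  acBasis_subset_tcBasis (Or.inr (Set.mem_iUnion.2 ⟨k, Or.inl rfl⟩))

/-- `∨ₖ ∈ tcBasis`. [folklore] -/
theorem or_mem_tcBasis (k : ℕ) : GateFn.or k ∈ tcBasis :=
  acBasis_subset_tcBasis (Or.inr (Set.mem_iUnion.2 ⟨k, Or.inr rfl⟩))

/-- `¬ ∈ tcBasis`. [folklore] -/
theorem not_mem_tcBasis' : GateFn.not ∈ tcBasis := acBasis_subset_tcBasis (Or.inl rfl)

/-- `MAJₖ ∈ tcBasis`. [folklore] -/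
theorem maj_mem_tcBasis (k : ℕ) : GateFn.maj k ∈ tcBasis := Or.inr (Set.mem_iUnion.2 ⟨k, rfl⟩)

/-- **Every gate of the threshold circuit is over the threshold basis.** [cite: DawarWilsenach2025, Thm 5.1 ("threshold circuit")] -/
theorem tfn_mem_tcBasis (l : Φ.TGate) : (Φ.tdag S).fn l ∈ tcBasis := by
  cases l with
  | one => exact and_mem_tcBasis 0
  | zero => exact or_mem_tcBasis 0
  | notx _ => exact not_mem_tcBasis'
  | thr _ _ _ => exact maj_mem_tcBasis _
  | neg _ _ _ => exact not_mem_tcBasis'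
  | exa _ _ _ => exact and_mem_tcBasis 2
  | prof _ _ => exact and_mem_tcBasis _
  | ind _ _ => exact or_mem_tcBasis _
  | out => exact or_mem_tcBasis _

/-- Hence every gate function of the threshold circuit is symmetric. [folklore] -/
theorem tfn_isSymmetric (l : Φ.TGate) : ((Φ.tdag S).fn l).IsSymmetric :=
  isSymmetric_of_mem_tcBasis (Φ.tfn_mem_tcBasis S l)

/-! ### Orbits of the threshold circuit -/

/-- The automorphisms of the threshold circuit induced by those of `Φ`, as a family of pairs
(input permutation, gate permutation). [folklore] -/
def indAuts : Set (Equiv.Perm (Fin n × Fin n) × Equiv.Perm Φ.TGate) :=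
  {a | ∃ (ρ : Equiv.Perm (Fin n)) (τ : Equiv.Perm G), Φ.IsAutomorphismExtending ρ τ ∧
    a = (Equiv.prodCongr ρ ρ, Φ.tperm ρ τ)}

/-- The diagonal permutation is the diagonal action. [folklore] -/
theorem coe_prodCongr_eq_diagAct (ρ : Equiv.Perm (Fin n)) :
    (⇑(Equiv.prodCongr ρ ρ) : Fin n × Fin n → Fin n × Fin n) = diagAct ρ := funext fun _ => rfl

/-- Every induced pair is an automorphism of the threshold circuit. [folklore] -/
theorem isAut_of_mem_indAuts {a : Equiv.Perm (Fin n × Fin n) × Equiv.Perm Φ.TGate} (ha : a ∈ Φ.indAuts) :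
    (Φ.tdag S).IsAut (⇑a.1) a.2 := by
  obtain ⟨ρ, τ, hτ, rfl⟩ := ha
  show (Φ.tdag S).IsAut (⇑(Equiv.prodCongr ρ ρ)) (Φ.tperm ρ τ)
  rw [coe_prodCongr_eq_diagAct]
  exact Φ.isAut_tdag S hτ

/-- For symmetric `Φ`, the induced pairs cover all diagonal input maps. [folklore] -/
theorem indAuts_cover (hsym : Φ.IsSymmetric (Equiv.Perm (Fin n))) :
    ∀ π ∈ GateDAG.diagMaps (Set.univ : Set (Equiv.Perm (Fin n))), ∃ a ∈ Φ.indAuts,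
      (⇑a.1 : Fin n × Fin n → Fin n × Fin n) = π := by
  rintro π ⟨ρ, -, rfl⟩
  obtain ⟨τ, hτ⟩ := hsym ρ
  exact ⟨_, ⟨ρ, τ, hτ, rfl⟩, funext fun q => rfl⟩

/-- **Traced orbits of the threshold circuit are bounded by the orbit size of `Φ`** (plus the
`n²` input negations and the fixed gates). [cite: DawarWilsenach2025, Thm 5.1 ("ORB(Ψ) = ORB(Φ)")] -/
theorem ncard_traced_le (l : Φ.TGate) :
    (GateDAG.traced Φ.indAuts l).ncard ≤ Φ.orbitSize (Equiv.Perm (Fin n)) + n ^ 2 + 1 := by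
  -- gates built over a gate `g` of `Φ`: the traced orbit is an image of the orbit of `g`
  have hg : ∀ (g : G) (f : G → Φ.TGate), (∀ ρ τ, Φ.tperm ρ τ (f g) = f (τ g)) →
      (GateDAG.traced Φ.indAuts (f g)).ncard ≤ Φ.orbitSize (Equiv.Perm (Fin n)) + n ^ 2 + 1 := by
    intro g f hf
    refine le_trans ?_ (Nat.le_add_right_of_le (Nat.le_add_right_of_le
      (Finset.le_sup (f := fun g => (Φ.autOrbit (Equiv.Perm (Fin n)) g).ncard) (Finset.mem_univ g))))
    refine le_trans (Set.ncard_le_ncard ?_ ((Set.toFinite _).image f)) (Set.ncard_image_le (Set.toFinite _))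
    rintro l' ⟨a, ⟨ρ, τ, hτ, rfl⟩, rfl⟩
    exact ⟨τ g, ⟨ρ, τ, hτ, rfl⟩, (hf ρ τ).symm⟩
  -- fixed gates
  have hfix : ∀ l₀ : Φ.TGate, (∀ ρ τ, Φ.tperm ρ τ l₀ = l₀) →
      (GateDAG.traced Φ.indAuts l₀).ncard ≤ Φ.orbitSize (Equiv.Perm (Fin n)) + n ^ 2 + 1 := by
    intro l₀ hl₀
    refine le_trans ?_ (Nat.le_add_left 1 _)
    rw [← Set.ncard_singleton l₀]
    refine Set.ncard_le_ncard ?_ (Set.toFinite _)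
    rintro l' ⟨a, ⟨ρ, τ, hτ, rfl⟩, rfl⟩
    exact hl₀ ρ τ
  cases l with
  | one => exact hfix _ fun _ _ => rfl
  | zero => exact hfix _ fun _ _ => rfl
  | out => exact hfix _ fun _ _ => rfl
  | notx x =>
    refine le_trans ?_ (Nat.le_add_right_of_le (Nat.le_add_left _ _))
    refine le_trans (Set.ncard_le_ncard ?_ (Set.toFinite _))
      ((GateDAG.ncard_range_le_card (TGate.notx : Fin n × Fin n → Φ.TGate)).trans ?_)
    · rintro l' ⟨a, ⟨ρ, τ, hτ, rfl⟩, rfl⟩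
      exact ⟨ρ • x, rfl⟩
    · rw [Fintype.card_prod, Fintype.card_fin, sq]
  | thr g c k => exact hg g (fun g' => .thr g' c k) fun _ _ => rfl
  | neg g c k => exact hg g (fun g' => .neg g' c k) fun _ _ => rfl
  | exa g c k => exact hg g (fun g' => .exa g' c k) fun _ _ => rfl
  | prof g p => exact hg g (fun g' => .prof g' p) fun _ _ => rfl
  | ind g c => exact hg g (fun g' => .ind g' c) fun _ _ => rfl

/-! ### The symmetric threshold circuit: assembly -/

/-- **The threshold circuit of `Φ` for the target set `S`**, as a straight-line program: the
reduced form (`GateDAG.reduce`, rigidification with `∧₁`-chains) of `Ψ(Φ, S)`, compiled.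
[cite: DawarWilsenach2025, Thm 5.1] -/
def thresholdCircuit : Circuit (Fin n × Fin n) := (Φ.tdag S).reduce.compile

/-- The threshold circuit is over the threshold basis. [cite: DawarWilsenach2025, Thm 5.1] -/
theorem thresholdCircuit_isOver : (Φ.thresholdCircuit S).IsOver tcBasis :=
  (Φ.tdag S).reduce.compile_isOver ((Φ.tdag S).reduce_fn_mem (Φ.tfn_mem_tcBasis S) and_one_mem_tcBasis)

/-- The threshold circuit is simply wired. [cite: DawarWilsenach2025, Thm 5.1] -/
theorem thresholdCircuit_hasSimpleWiring : (Φ.thresholdCircuit S).HasSimpleWiring :=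
  (Φ.tdag S).reduce.compile_hasSimpleWiring (Φ.tdag S).reduce_args_injective

/-- **The threshold circuit is square-symmetric** if `Φ` is. [cite: DawarWilsenach2025, Thm 5.1 ("Γ-symmetric threshold circuit")] -/
theorem thresholdCircuit_isSymmetricUnder (hsym : Φ.IsSymmetric (Equiv.Perm (Fin n))) :
    (Φ.thresholdCircuit S).IsSymmetricUnder Set.univ := by
  unfold thresholdCircuit
  rw [GateDAG.isSymmetricUnder_compile_iff]
  intro π hπ
  obtain ⟨a, ha, rfl⟩ := Φ.indAuts_cover hsym π hπ
  exact ⟨_, (Φ.isAut_of_mem_indAuts S ha).reduce⟩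

/-- **The threshold circuit decides `Φ[A] ∈ S` on `0/1` inputs.** [cite: DawarWilsenach2025, Thm 5.1 ("Φ[M] ∈ S iff Ψ[M] = 1")] -/
theorem thresholdCircuit_eval (A : Fin n × Fin n → Bool) :
    (Φ.thresholdCircuit S).eval A = true ↔
      MvPolynomial.eval (fun ij => if A ij = true then (1 : F) else 0) (Φ.eval (Φ.output ())) ∈ S := by
  unfold thresholdCircuit
  rw [GateDAG.compile_eval, GateDAG.evalOut_reduce _ (Φ.tfn_isSymmetric S), Φ.evalOut_tdag S A,
    decide_eq_true_iff]
  exact Iff.rfl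

/-- **Orbit size of the threshold circuit**: at most `ORB(Φ) + n² + 1`. [cite: DawarWilsenach2025, Thm 5.1 ("ORB(Ψ) = ORB(Φ)")] -/
theorem thresholdCircuit_orbitSize_le (hsym : Φ.IsSymmetric (Equiv.Perm (Fin n))) :
    (Φ.thresholdCircuit S).orbitSize Set.univ ≤ Φ.orbitSize (Equiv.Perm (Fin n)) + n ^ 2 + 1 := by
  unfold thresholdCircuit
  refine (Φ.tdag S).reduce.orbitSize_compile_le _ fun g => ?_
  refine (GateDAG.ncard_orbit_reduce_le Φ.indAuts (fun a ha => Φ.isAut_of_mem_indAuts S ha)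
    (Φ.indAuts_cover hsym) (Φ.ncard_traced_le) g).trans (max_le le_rfl ?_)
  rw [Fintype.card_prod, Fintype.card_fin, sq]
  omega

end LabelledArithCircuit

/-- **Dawar–Wilsenach 2025, Theorem 5.1, in the family form consumed by the proof of Theorem 7.1**
(`DawarWilsenach2025_thm71_of_thm51_thm64_thm72`, hypothesis `h51`): a family `(Φ_n)` of
square-symmetric arithmetic circuits over a field `F` of orbit size `2^{o(n)}`, together with
target sets `S_n ⊆ F`, yields a family `(Ψ_n)` of simply wired, square-symmetric threshold
(`tcBasis`) circuits of orbit size `2^{o(n)}` such that `Ψ_n[A] = 1 ⟺ Φ_n[A] ∈ S_n` for every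
`0/1` matrix `A`. Printed: "Let `Φ` be a `Γ`-symmetric arithmetic circuit over a field `F` …
and let `S ⊆ F` be finite. Then there is a `Γ`-symmetric threshold circuit `Ψ` with
`ORB(Ψ) = ORB(Φ)`, such that for all `M ∈ {0,1}^X` we have `Φ[M] ∈ S` if, and only if,
`Ψ[M] = 1`"; here with the orbit bound `ORB(Ψ_n) ≤ ORB(Φ_n) + n² + 1` (the `n²` negated input
wires and the constants, which in print are not counted or are input gates), which preserves
`2^{o(n)}`. Finiteness of `S_n` is not needed (only finitely many values occur). Construction:
`LabelledArithCircuit.thresholdCircuit` — indicator gates "`v` evaluates to `c`" for every gate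
`v` and value `c`, realised with majority gates over the indicators of the children (the paper's
partition-symmetric functions `F_c[v]`, Lemma 5.3), then rigidified (`GateDAG.reduce`,
Anderson–Dawar Lemma 7) and compiled. [cite: DawarWilsenach2025, Thm 5.1 (pp. 13–16)] -/
theorem DawarWilsenach2025_thm51_family :
    ∀ (F : Type) [Field F] [CharZero F] (G : ℕ → Type) [∀ n, Fintype (G n)]
      (Φ : ∀ n, LabelledArithCircuit F (Fin n × Fin n) Unit (G n)) (S : ℕ → Set F),
      (∀ n, (Φ n).IsSymmetric (Equiv.Perm (Fin n))) → (∀ n, (S n).Finite) →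
      (∀ ε : ℝ, 0 < ε → ∀ᶠ n : ℕ in Filter.atTop,
        ((Φ n).orbitSize (Equiv.Perm (Fin n)) : ℝ) ≤ (2 : ℝ) ^ (ε * (n : ℝ))) →
      ∃ Ψ : ∀ n, Circuit (Fin n × Fin n),
        (∀ n, (Ψ n).IsOver tcBasis ∧ (Ψ n).IsSymmetricUnder Set.univ ∧ (Ψ n).HasSimpleWiring) ∧
        (∀ ε : ℝ, 0 < ε → ∀ᶠ n : ℕ in Filter.atTop,
          ((Ψ n).orbitSize Set.univ : ℝ) ≤ (2 : ℝ) ^ (ε * (n : ℝ))) ∧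
        ∀ (n : ℕ) (A : Fin n × Fin n → Bool), (Ψ n).eval A = true ↔
          MvPolynomial.eval (fun ij => if A ij = true then (1 : F) else 0)
            ((Φ n).eval ((Φ n).output ())) ∈ S n := by
  intro F _ _ G _ Φ S hsym _ horb
  refine ⟨fun n => (Φ n).thresholdCircuit (S n), fun n => ⟨(Φ n).thresholdCircuit_isOver (S n),
    (Φ n).thresholdCircuit_isSymmetricUnder (S n) (hsym n), (Φ n).thresholdCircuit_hasSimpleWiring (S n)⟩,
    fun ε hε => ?_, fun n A => (Φ n).thresholdCircuit_eval (S n) A⟩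
  -- orbit size `2^{o(n)}`: `ORB(Ψ_n) ≤ ORB(Φ_n) + n² + 1 ≤ (ORB(Φ_n) + n²) + n²` for `n ≥ 1`
  have h1 : ∀ δ : ℝ, 0 < δ → ∀ᶠ n : ℕ in Filter.atTop,
      (((fun n => (Φ n).orbitSize (Equiv.Perm (Fin n)) + n ^ 2) n : ℕ) : ℝ) ≤ (2 : ℝ) ^ (δ * (n : ℝ)) :=
    fun δ hδ => Literature.ModelTheory.FiniteModelTheory.eventually_add_sq_le_two_rpow horb hδ
  have h2 := Literature.ModelTheory.FiniteModelTheory.eventually_add_sq_le_two_rpow h1 hε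
  filter_upwards [h2, Filter.eventually_ge_atTop 1] with n hn hn1
  refine le_trans ?_ hn
  have := (Φ n).thresholdCircuit_orbitSize_le (S n) (hsym n)
  have hsq : 1 ≤ n ^ 2 := Nat.one_le_pow _ _ hn1
  exact_mod_cast (this.trans (by omega))

end Literature.Computability.AlgebraicComplexity
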